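import Summits.BirchSwinnertonDyer.BirchSwinnertonDyer.Theorems.AdditiveBranchIMCGordTwoRankOneUnitCoeff
import Summits.BirchSwinnertonDyer.BirchSwinnertonDyer.Theorems.AdditiveBranchIMCGordTwoRankOneVisibilityRecord205623g1
import Summits.BirchSwinnertonDyer.BirchSwinnertonDyer.Theorems.AdditiveBranchIMCGordTwoRankOneVisibilityRecord355392y1
import Summits.BirchSwinnertonDyer.BirchSwinnertonDyer.Theorems.AdditiveBranchIMCGordTwoRankOneVisibilityRecord417024bc1
import Summits.BirchSwinnertonDyer.BirchSwinnertonDyer.Theorems.AdditiveBranchIMCGordTwoRankOneVisibilityRecord449352f1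
import HarnessLib

/-!
# Crux `GordTwoRankOne` (item 19358): `BSD(E,3)` BY NAME on the four CONTENT-window keys with visibility records —
# one theorem per key, binders = cite-only facts + the two-engine `A′(E,3) ≠ 0` + Cremona data + the displayed `3`-congruence

Cell `bsd-addord`, seat `bsd-addord-k1-c3` (D-0074 row B2), gen 7. HONEST FRAMING: nothing here proves the Birch–Swinnerton-Dyer
conjecture or the crux; THEOREMS ONLY; per pair (an OFFER shape for referee A); NOT a class theorem; nothing booked by this file.

## What

* `classX4Gord_bsdp_rankOne_three_of_katoHalf_of_branchCoeffOneNeZero_of_lower` — the booking door of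
  `…GordTwoRankOneVisibilityBooking.lean` (sibling, same upper-half chain) with the LOWER half taken as a hypothesis `MissingLowerBoundAt W 3` (so that a per-pair KERNEL
  record plugs in directly); UPPER half = Kato half-eigenspace reading `hK` + the cyclotomic-line identity (cite-only `hCyc hArt h73 hWald hmod
  hmodD hmodN hGZK`) + Schneider from the weak certificate `A′(E,3) ≠ 0`.
* `bsdp_c<E>_3_of_congr` for `E ∈ {205623g1, 355392y1, 417024bc1, 449352f1}`: `BSD(E,3)` from the cite-only facts `hK hCT hCyc hArt h73 hWald
  hmod hmodD hmodN hGZK`, the data-level flags `ClassX4Gord W 3`, `Surj W 3`, `r_an = 1` (Cremona / the cell's census), the EXACT datum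
  `#Ш(E)_an = q`, `ord₃ q ≤ 2` (Cremona: `#Ш_an = 9`), the two-engine certificate `BranchCoeffOneNeZeroAt W 3` (p = 3 engine tier, gz5-p3 engines
  byte-identical, k1-c3 g7 kit j264576/j264578), and the displayed `3`-congruence `θ : F[3] ⥲ E[3]` of the record's partner `F` — the LOWER half
  being the kernel record `missingLowerBoundAt_c<E>_3_of_congr`.
-/

set_option autoImplicit false
set_option linter.dupNamespace false

noncomputable section

open scoped Classical MatrixGroups ModularForm NumberField
open CongruenceSubgroup WeierstrassCurve NumberField IsDedekindDomain Field
  Literature.NumberTheory.EllipticCurves Literature.NumberTheory.EllipticCurves.ModularForms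
  Literature.NumberTheory.EllipticCurves.GreenbergVatsal2000
  Literature.NumberTheory.EllipticCurves.Rank1Residual
  Literature.NumberTheory.EllipticCurves.Rank1Residual.Typed
  Literature.NumberTheory.EllipticCurves.Delbourgo2002
  Literature.NumberTheory.EllipticCurves.Disegni2017
  Literature.NumberTheory.GaloisRepresentations
  Summit.BirchSwinnertonDyer.Rank1Residual.AdditivePotMult
  Summit.BirchSwinnertonDyer.Rank1Residual.Additive
  Summit.BirchSwinnertonDyer.Rank1Residual.GaloisImage

namespace Summit.BirchSwinnertonDyer.BirchSwinnertonDyer.Theorems.AdditiveBranchIMCGordTwoRankOne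

open Summit.BirchSwinnertonDyer.BirchSwinnertonDyer.Theorems.AdditiveBranchIMCGordTwoRankOneVisibility

/-- **X4♯(G-ord) ∩ surj at `p = 3`, `r_an(E) = 1`: `BSD(E,3)` from the Kato half, the cite-only facts, `A′(E,3) ≠ 0` and a GIVEN lower half
`MissingLowerBoundAt W 3`** (the socket a per-pair visibility / descent record plugs into). UPPER half verbatim as
`classX4Gord_bsdp_rankOne_three_of_katoHalf_of_branchCoeffOneNeZero_of_twoWitnesses`. Per pair; NOT a class theorem; nothing booked.
[cite: Kato2004Asterisque, Thm. 17.4 (3) (p. 273)] [cite: Wuthrich2014, Thm. 16 (p. 397)] [cite: Delbourgo2002, Theorem (B), Example (p. 40)]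
[cite: Disegni2017, Theorem A/B (arXiv v3 PDF 7–9)] [cite: Miller2011LMS, Def. 1.1] -/
theorem classX4Gord_bsdp_rankOne_three_of_katoHalf_of_branchCoeffOneNeZero_of_lower
    [Fact (Nat.Prime 3)] {W : WeierstrassCurve ℚ} [W.IsElliptic] [W.IsGloballyMinimal]
    (hK : Wuthrich2014.kato_halfEigenCharIdeal_dvd_cyclotomicPrime_of_surjective)
    (hCyc : delbourgoDatum_cycLineGrossZagier)
    (hArt : rankinSelbergEulerProductHecke_baseChangeDirichlet_eq) (h73 : GrossZagier1986_thm_I_7_3)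
    (hWald : waldspurger_exists_heegnerField_twist_ne_zero)
    (hmod : hasEntireLFunction_rat) (hmodD : nonempty_modularParametrizationData)
    (hmodN : exists_isNewformOf) (hGZK : rank_eq_analyticRank_of_analyticRank_le_one)
    (hX : ClassX4Gord W 3) (hsurj : Surj W 3) (hr : W.analyticRank = 1) (hne : BranchCoeffOneNeZeroAt W 3)
    (hl : MissingLowerBoundAt W 3) : BSDp W 3 := by
  have hp4 : (3 : ℕ) % 4 = 3 := by norm_num
  have hp2 : (3 : ℕ) ≠ 2 := by norm_num
  have hcm : ¬ W.HasCM := not_hasCM_of_surj_of_ne_two hp2 hsurj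
  have he : semistabilityIndex W 3 = 2 :=
    semistabilityIndex_eq_two_of_typeG_three W hX.typeGOrd.typeG hX.addv.2
  obtain ⟨V, iV, iVm, C, hV, hC⟩ := hX.exists_goodOrd_pStar_twist_model W 3 he
  have hordin : IsOrdinaryAt V 3 := ⟨hV.1, hV.2⟩
  haveI : NeZero (V.conductorNorm ℤ) := ⟨(V.conductorNorm_pos_holds).ne'⟩
  obtain ⟨Dm⟩ := hmodD V
  obtain ⟨ϖ, -, hϖ⟩ := exists_rat_mul_imaginaryPeriodRat_eq_minusPeriod Dm
  obtain ⟨Dh, hB, u, q, hlead, hpgz⟩ := exists_datum_identity_three_of_facts hCyc hArt h73 hWald hmod hmodD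
    hmodN hGZK hX.addv.2 hX.typeGOrd hcm hr V C hV hC Dm.isNewformOf ϖ hϖ
  have hSch : SchneiderConjecture Dh :=
    schneiderConjecture_of_identity_of_branchCoeffOneNeZero_odd hp4 hne V C hC hordin Dm.f Dm.isNewformOf ϖ
      hϖ hpgz
  have hu : MissingUpperBoundAt W 3 :=
    classX4Gord_missingUpperBoundAt_rankOne_of_katoHalf_of_identity_odd hK hGZK hmod hX hp4 hsurj hr hB hSch V hV
      C hC Dm.isNewformOf ϖ hϖ hlead hpgz
  exact bsdp_of_missingPPartAt W 3 hGZK (by rw [hr]) (missingPPartAt_of_lower_of_upper W 3 hl hu)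

/-- **`BSD(E,3)` for `E = 205623g1` BY NAME** — cite-only `hK hCT hCyc hArt h73 hWald hmod hmodD hmodN hGZK`; data-level flags `ClassX4Gord W 3`,
`Surj W 3`, `r_an = 1` (the cell's census / Cremona); the EXACT datum `#Ш(E)_an = q`, `ord₃ q ≤ 2` (Cremona `#Ш_an = 9`); the two-engine weak
certificate `A′(E,3) ≠ 0` (`hne`); the displayed `3`-congruence `θ : F[3] ⥲ E[3]` with `F = 159929a1`; LOWER half = the kernel record
`missingLowerBoundAt_c205623g1_3_of_congr`. Per pair; NOT a class theorem; nothing booked. [cite: CremonaMazur2000, §3]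
[cite: Kato2004Asterisque, Thm. 17.4 (3) (p. 273)] [cite: Miller2011LMS, Def. 1.1] [cite: Cremona2006, Table 1 (Cremona labels 205623g1, 159929a1)] -/
theorem bsdp_c205623g1_3_of_congr
    (hK : Wuthrich2014.kato_halfEigenCharIdeal_dvd_cyclotomicPrime_of_surjective)
    (hCT : exists_casselsTate_pairing (K := ℚ)) (hCyc : delbourgoDatum_cycLineGrossZagier)
    (hArt : rankinSelbergEulerProductHecke_baseChangeDirichlet_eq) (h73 : GrossZagier1986_thm_I_7_3)
    (hWald : waldspurger_exists_heegnerField_twist_ne_zero)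
    (hmod : hasEntireLFunction_rat) (hmodD : nonempty_modularParametrizationData)
    (hmodN : exists_isNewformOf) (hGZK : rank_eq_analyticRank_of_analyticRank_le_one)
    {W F : WeierstrassCurve ℚ} [W.IsElliptic] [W.IsGloballyMinimal] [F.IsElliptic] [F.IsGloballyMinimal]
    (hWeq : W = ⟨0, 0, 1, -4269, -107357⟩) (hFeq : F = ⟨1, 1, 1, -111, 10⟩)
    (hX : ClassX4Gord W 3) (hsurj : Surj W 3) (hr1 : W.analyticRank = 1) (hne : BranchCoeffOneNeZeroAt W 3)
    {q : ℚ} (hq : shaAn W = (q : ℂ)) (hv : padicValRat 3 q ≤ 2)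
    (θ : geomTorsion F (3 : ℤ) ≃+ geomTorsion W (3 : ℤ))
    (hθ : ∀ (σ : Field.absoluteGaloisGroup ℚ) (P : geomTorsion F (3 : ℤ)), θ (σ • P) = σ • θ P) : BSDp W 3 :=
  haveI : Fact (Nat.Prime 3) := ⟨by norm_num⟩
  classX4Gord_bsdp_rankOne_three_of_katoHalf_of_branchCoeffOneNeZero_of_lower hK hCyc hArt h73 hWald hmod hmodD hmodN hGZK
    hX hsurj hr1 hne (missingLowerBoundAt_c205623g1_3_of_congr hCT hGZK hWeq hFeq hr1 hq hv θ hθ)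

/-- **`BSD(E,3)` for `E = 355392y1` BY NAME** — cite-only `hK hCT hCyc hArt h73 hWald hmod hmodD hmodN hGZK`; data-level flags `ClassX4Gord W 3`,
`Surj W 3`, `r_an = 1` (the cell's census / Cremona); the EXACT datum `#Ш(E)_an = q`, `ord₃ q ≤ 2` (Cremona `#Ш_an = 9`); the two-engine weak
certificate `A′(E,3) ≠ 0` (`hne`); the displayed `3`-congruence `θ : F[3] ⥲ E[3]` with `F = 355392a1`; LOWER half = the kernel record
`missingLowerBoundAt_c355392y1_3_of_congr`. Per pair; NOT a class theorem; nothing booked. [cite: CremonaMazur2000, §3]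
[cite: Kato2004Asterisque, Thm. 17.4 (3) (p. 273)] [cite: Miller2011LMS, Def. 1.1] [cite: Cremona2006, Table 1 (Cremona labels 355392y1, 355392a1)] -/
theorem bsdp_c355392y1_3_of_congr
    (hK : Wuthrich2014.kato_halfEigenCharIdeal_dvd_cyclotomicPrime_of_surjective)
    (hCT : exists_casselsTate_pairing (K := ℚ)) (hCyc : delbourgoDatum_cycLineGrossZagier)
    (hArt : rankinSelbergEulerProductHecke_baseChangeDirichlet_eq) (h73 : GrossZagier1986_thm_I_7_3)
    (hWald : waldspurger_exists_heegnerField_twist_ne_zero)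
    (hmod : hasEntireLFunction_rat) (hmodD : nonempty_modularParametrizationData)
    (hmodN : exists_isNewformOf) (hGZK : rank_eq_analyticRank_of_analyticRank_le_one)
    {W F : WeierstrassCurve ℚ} [W.IsElliptic] [W.IsGloballyMinimal] [F.IsElliptic] [F.IsGloballyMinimal]
    (hWeq : W = ⟨0, 0, 0, -259500, -50924752⟩) (hFeq : F = ⟨0, 0, 0, -1884, 23024⟩)
    (hX : ClassX4Gord W 3) (hsurj : Surj W 3) (hr1 : W.analyticRank = 1) (hne : BranchCoeffOneNeZeroAt W 3)
    {q : ℚ} (hq : shaAn W = (q : ℂ)) (hv : padicValRat 3 q ≤ 2)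
    (θ : geomTorsion F (3 : ℤ) ≃+ geomTorsion W (3 : ℤ))
    (hθ : ∀ (σ : Field.absoluteGaloisGroup ℚ) (P : geomTorsion F (3 : ℤ)), θ (σ • P) = σ • θ P) : BSDp W 3 :=
  haveI : Fact (Nat.Prime 3) := ⟨by norm_num⟩
  classX4Gord_bsdp_rankOne_three_of_katoHalf_of_branchCoeffOneNeZero_of_lower hK hCyc hArt h73 hWald hmod hmodD hmodN hGZK
    hX hsurj hr1 hne (missingLowerBoundAt_c355392y1_3_of_congr hCT hGZK hWeq hFeq hr1 hq hv θ hθ)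

/-- **`BSD(E,3)` for `E = 417024bc1` BY NAME** — cite-only `hK hCT hCyc hArt h73 hWald hmod hmodD hmodN hGZK`; data-level flags `ClassX4Gord W 3`,
`Surj W 3`, `r_an = 1` (the cell's census / Cremona); the EXACT datum `#Ш(E)_an = q`, `ord₃ q ≤ 2` (Cremona `#Ш_an = 9`); the two-engine weak
certificate `A′(E,3) ≠ 0` (`hne`); the displayed `3`-congruence `θ : F[3] ⥲ E[3]` with `F = 46336j1`; LOWER half = the kernel record
`missingLowerBoundAt_c417024bc1_3_of_congr`. Per pair; NOT a class theorem; nothing booked. [cite: CremonaMazur2000, §3]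
[cite: Kato2004Asterisque, Thm. 17.4 (3) (p. 273)] [cite: Miller2011LMS, Def. 1.1] [cite: Cremona2006, Table 1 (Cremona labels 417024bc1, 46336j1)] -/
theorem bsdp_c417024bc1_3_of_congr
    (hK : Wuthrich2014.kato_halfEigenCharIdeal_dvd_cyclotomicPrime_of_surjective)
    (hCT : exists_casselsTate_pairing (K := ℚ)) (hCyc : delbourgoDatum_cycLineGrossZagier)
    (hArt : rankinSelbergEulerProductHecke_baseChangeDirichlet_eq) (h73 : GrossZagier1986_thm_I_7_3)
    (hWald : waldspurger_exists_heegnerField_twist_ne_zero)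
    (hmod : hasEntireLFunction_rat) (hmodD : nonempty_modularParametrizationData)
    (hmodN : exists_isNewformOf) (hGZK : rank_eq_analyticRank_of_analyticRank_le_one)
    {W F : WeierstrassCurve ℚ} [W.IsElliptic] [W.IsGloballyMinimal] [F.IsElliptic] [F.IsGloballyMinimal]
    (hWeq : W = ⟨0, 0, 0, -5616984, -5123926528⟩) (hFeq : F = ⟨0, -1, 0, -45, 181⟩)
    (hX : ClassX4Gord W 3) (hsurj : Surj W 3) (hr1 : W.analyticRank = 1) (hne : BranchCoeffOneNeZeroAt W 3)
    {q : ℚ} (hq : shaAn W = (q : ℂ)) (hv : padicValRat 3 q ≤ 2)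
    (θ : geomTorsion F (3 : ℤ) ≃+ geomTorsion W (3 : ℤ))
    (hθ : ∀ (σ : Field.absoluteGaloisGroup ℚ) (P : geomTorsion F (3 : ℤ)), θ (σ • P) = σ • θ P) : BSDp W 3 :=
  haveI : Fact (Nat.Prime 3) := ⟨by norm_num⟩
  classX4Gord_bsdp_rankOne_three_of_katoHalf_of_branchCoeffOneNeZero_of_lower hK hCyc hArt h73 hWald hmod hmodD hmodN hGZK
    hX hsurj hr1 hne (missingLowerBoundAt_c417024bc1_3_of_congr hCT hGZK hWeq hFeq hr1 hq hv θ hθ)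

/-- **`BSD(E,3)` for `E = 449352f1` BY NAME** — cite-only `hK hCT hCyc hArt h73 hWald hmod hmodD hmodN hGZK`; data-level flags `ClassX4Gord W 3`,
`Surj W 3`, `r_an = 1` (the cell's census / Cremona); the EXACT datum `#Ш(E)_an = q`, `ord₃ q ≤ 2` (Cremona `#Ш_an = 9`); the two-engine weak
certificate `A′(E,3) ≠ 0` (`hne`); the displayed `3`-congruence `θ : F[3] ⥲ E[3]` with `F = 449352b1`; LOWER half = the kernel record
`missingLowerBoundAt_c449352f1_3_of_congr`. Per pair; NOT a class theorem; nothing booked. [cite: CremonaMazur2000, §3]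
[cite: Kato2004Asterisque, Thm. 17.4 (3) (p. 273)] [cite: Miller2011LMS, Def. 1.1] [cite: Cremona2006, Table 1 (Cremona labels 449352f1, 449352b1)] -/
theorem bsdp_c449352f1_3_of_congr
    (hK : Wuthrich2014.kato_halfEigenCharIdeal_dvd_cyclotomicPrime_of_surjective)
    (hCT : exists_casselsTate_pairing (K := ℚ)) (hCyc : delbourgoDatum_cycLineGrossZagier)
    (hArt : rankinSelbergEulerProductHecke_baseChangeDirichlet_eq) (h73 : GrossZagier1986_thm_I_7_3)
    (hWald : waldspurger_exists_heegnerField_twist_ne_zero)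
    (hmod : hasEntireLFunction_rat) (hmodD : nonempty_modularParametrizationData)
    (hmodN : exists_isNewformOf) (hGZK : rank_eq_analyticRank_of_analyticRank_le_one)
    {W F : WeierstrassCurve ℚ} [W.IsElliptic] [W.IsGloballyMinimal] [F.IsElliptic] [F.IsGloballyMinimal]
    (hWeq : W = ⟨0, 0, 0, -917427, 284976542⟩) (hFeq : F = ⟨0, 0, 0, -6636, 208244⟩)
    (hX : ClassX4Gord W 3) (hsurj : Surj W 3) (hr1 : W.analyticRank = 1) (hne : BranchCoeffOneNeZeroAt W 3)
    {q : ℚ} (hq : shaAn W = (q : ℂ)) (hv : padicValRat 3 q ≤ 2)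
    (θ : geomTorsion F (3 : ℤ) ≃+ geomTorsion W (3 : ℤ))
    (hθ : ∀ (σ : Field.absoluteGaloisGroup ℚ) (P : geomTorsion F (3 : ℤ)), θ (σ • P) = σ • θ P) : BSDp W 3 :=
  haveI : Fact (Nat.Prime 3) := ⟨by norm_num⟩
  classX4Gord_bsdp_rankOne_three_of_katoHalf_of_branchCoeffOneNeZero_of_lower hK hCyc hArt h73 hWald hmod hmodD hmodN hGZK
    hX hsurj hr1 hne (missingLowerBoundAt_c449352f1_3_of_congr hCT hGZK hWeq hFeq hr1 hq hv θ hθ)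

end Summit.BirchSwinnertonDyer.BirchSwinnertonDyer.Theorems.AdditiveBranchIMCGordTwoRankOne

end
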